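import Summits.NavierStokesRegularity.NavierStokesRegularity.Theorems.OddMorawetzLocal.Negative.OddMorawetzLocalJetAlgebra
import HarnessLib

/-!
# Crux `OddMorawetzLocal` (stmt-NavierStokesRegularity-1376) — the insertion sorts and enumerations of the jet algebra

Sorting lemmas for the refutation's computable jet algebra (`OddMorawetzLocalJetAlgebra`), consumed by the
completeness / duplicate-freeness theorem `idx_complete` of the monomial basis `idx k`
(`Theorems/OddMorawetzOddMorawetzLocalIdxComplete.lean`).  Mathlib only (`List.insertionSort`, `List.Perm`,
`List.Pairwise`, `List.Nodup`); no named facts, no new definitions.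

* `idxCmp` / `JVar.cmp` behave like a linear order: `eq` exactly on the diagonal, `swap`-antisymmetric, transitive;
  the relation `v ≼ w :↔ JVar.cmp w v ≠ lt` (written out, never named) is reflexive, total, antisymmetric and
  transitive.
* `insertVar` / `sortVars` ARE `List.orderedInsert` / `List.insertionSort` for `≼`, and `insertIdx` / `sortIdx` are
  those for `≤` on `Fin 3`; hence `sortVars m ~ m`, `sortVars m` is `≼`-sorted, `sortVars` is invariant under
  permutations and idempotent, lists with equal sortings are permutations of each other, and
  `sortIdx l = l ↔ l` is `≤`-sorted.
* the enumerations: `l ∈ sortedIdxFrom n i₀ ↔` (`l.length = n`, `l` sorted, entries `≥ i₀`);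
  `v ∈ varsOfOrder n ↔ v.2.length = n ∧ sortIdx v.2 = v.2`; `sh ∈ shapes k ↔ sh = [n₁, n₂, n₃]` with
  `n₁ ≤ n₂ ≤ n₃ ≤ 3`, `n₁ + n₂ + n₃ = k`; all three lists are duplicate-free.
-/

noncomputable section

set_option linter.dupNamespace false

namespace Summit.NavierStokesRegularity.NavierStokesRegularity.Theorems.OddMorawetz

/-! ### `idxCmp` and `JVar.cmp` are linear orders -/

/-- `idxCmp` is reflexive (value `eq` on the diagonal). -/
theorem idxCmp_self (l : List (Fin 3)) : idxCmp l l = .eq := by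
  induction l with
  | nil => rfl
  | cons i l ih => simp [idxCmp, ih]

/-- `idxCmp l l' = eq` only on the diagonal. -/
theorem eq_of_idxCmp_eq_eq {l l' : List (Fin 3)} (h : idxCmp l l' = .eq) : l = l' := by
  induction l generalizing l' with
  | nil => cases l' with | nil => rfl | cons j l' => simp [idxCmp] at h
  | cons i l ih =>
    cases l' with
    | nil => simp [idxCmp] at h
    | cons j l' =>
      simp only [idxCmp] at h
      split_ifs at h with h₁ h₂
      obtain rfl : i = j := le_antisymm (not_lt.1 h₂) (not_lt.1 h₁)
      rw [ih h]

/-- `idxCmp` is antisymmetric: swapping the arguments swaps the answer. -/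
theorem idxCmp_swap (l l' : List (Fin 3)) : (idxCmp l l').swap = idxCmp l' l := by
  induction l generalizing l' with
  | nil => cases l' <;> rfl
  | cons i l ih =>
    cases l' with
    | nil => rfl
    | cons j l' =>
      simp only [idxCmp]
      by_cases h₁ : i < j
      · simp [h₁, lt_asymm h₁]
      · by_cases h₂ : j < i
        · simp [h₁, h₂]
        · simp [h₁, h₂, ih]

/-- `idxCmp` is transitive in the form `a ≤ b → b ≤ c → a ≤ c` (`≤` meaning "not `gt`"). -/
theorem idxCmp_le_trans {a b c : List (Fin 3)} (hab : idxCmp a b ≠ .gt) (hbc : idxCmp b c ≠ .gt) :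
    idxCmp a c ≠ .gt := by
  induction a generalizing b c with
  | nil => cases c <;> simp [idxCmp]
  | cons i a ih =>
    cases b with
    | nil => simp [idxCmp] at hab
    | cons j b =>
      cases c with
      | nil => simp [idxCmp] at hbc
      | cons k c =>
        simp only [idxCmp] at hab hbc ⊢
        split_ifs at hab with h₁ h₂ <;> split_ifs at hbc with h₃ h₄ <;> split_ifs with h₅ h₆ <;>
          first
            | exact ih hab hbc
            | decide
            | exact absurd rfl hab
            | exact absurd rfl hbc
            | (simp only [Fin.lt_def] at *; omega)

/-- `JVar.cmp` is reflexive. -/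
theorem JVar.cmp_self (v : JVar) : JVar.cmp v v = .eq := by
  simp [JVar.cmp, idxCmp_self]

/-- `JVar.cmp v w = eq` only on the diagonal. -/
theorem JVar.eq_of_cmp_eq_eq {v w : JVar} (h : JVar.cmp v w = .eq) : v = w := by
  obtain ⟨a, l⟩ := v
  obtain ⟨b, l'⟩ := w
  simp only [JVar.cmp] at h
  split_ifs at h with h₁ h₂
  obtain rfl : a = b := le_antisymm (not_lt.1 h₂) (not_lt.1 h₁)
  rw [eq_of_idxCmp_eq_eq h]

/-- `JVar.cmp` is antisymmetric: swapping the arguments swaps the answer. -/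
theorem JVar.cmp_swap (v w : JVar) : (JVar.cmp v w).swap = JVar.cmp w v := by
  obtain ⟨a, l⟩ := v
  obtain ⟨b, l'⟩ := w
  simp only [JVar.cmp]
  by_cases h₁ : a < b
  · simp [h₁, lt_asymm h₁]
  · by_cases h₂ : b < a
    · simp [h₁, h₂]
    · simp [h₁, h₂, idxCmp_swap]

/-- `JVar.cmp v w = gt ↔ JVar.cmp w v = lt`. -/
theorem JVar.cmp_eq_gt_iff {v w : JVar} : JVar.cmp v w = .gt ↔ JVar.cmp w v = .lt := by
  rw [← JVar.cmp_swap w v]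
  cases JVar.cmp w v <;> decide

/-- `JVar.cmp` is transitive in the form `u ≤ v → v ≤ w → u ≤ w` (`≤` meaning "not `gt`"). -/
theorem JVar.cmp_le_trans {u v w : JVar} (huv : JVar.cmp u v ≠ .gt) (hvw : JVar.cmp v w ≠ .gt) :
    JVar.cmp u w ≠ .gt := by
  obtain ⟨a, l⟩ := u
  obtain ⟨b, l'⟩ := v
  obtain ⟨c, l''⟩ := w
  simp only [JVar.cmp] at huv hvw ⊢
  split_ifs at huv with h₁ h₂ <;> split_ifs at hvw with h₃ h₄ <;> split_ifs with h₅ h₆ <;>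
    first
      | exact idxCmp_le_trans huv hvw
      | decide
      | exact absurd rfl huv
      | exact absurd rfl hvw
      | (simp only [Fin.lt_def] at *; omega)

/-- The relation `v ≼ w :↔ JVar.cmp w v ≠ lt` sorted by `insertVar` is total. -/
theorem JVar.le_total (v w : JVar) : JVar.cmp w v ≠ .lt ∨ JVar.cmp v w ≠ .lt := by
  by_contra h
  simp only [not_or, not_not] at h
  have h' := JVar.cmp_eq_gt_iff.2 h.1
  rw [h.2] at h'
  exact absurd h' (by decide)

/-- `≼` is antisymmetric. -/
theorem JVar.le_antisymm {v w : JVar} (h₁ : JVar.cmp w v ≠ .lt) (h₂ : JVar.cmp v w ≠ .lt) : v = w := by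
  apply JVar.eq_of_cmp_eq_eq
  have h₁' : JVar.cmp v w ≠ .gt := fun h => h₁ (JVar.cmp_eq_gt_iff.1 h)
  cases h : JVar.cmp v w <;> simp_all

/-- `≼` is transitive. -/
theorem JVar.le_trans {u v w : JVar} (h₁ : JVar.cmp v u ≠ .lt) (h₂ : JVar.cmp w v ≠ .lt) : JVar.cmp w u ≠ .lt :=
  fun h => JVar.cmp_le_trans (fun h' => h₁ (JVar.cmp_eq_gt_iff.1 h')) (fun h' => h₂ (JVar.cmp_eq_gt_iff.1 h'))
    (JVar.cmp_eq_gt_iff.2 h)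

/-! ### `sortVars` / `sortIdx` are insertion sorts -/

/-- `insertVar` is `List.orderedInsert` for `≼`. -/
theorem insertVar_eq_orderedInsert (v : JVar) (l : List JVar) :
    insertVar v l = l.orderedInsert (fun v w : JVar => JVar.cmp w v ≠ .lt) v := by
  induction l with
  | nil => rfl
  | cons w ws ih =>
    simp only [insertVar, List.orderedInsert_cons, ne_eq]
    split <;> simp_all

/-- Unfolding `sortVars` on a cons. -/
theorem sortVars_cons (v : JVar) (m : List JVar) : sortVars (v :: m) = insertVar v (sortVars m) := rfl

/-- `sortVars` is `List.insertionSort` for `≼`. -/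
theorem sortVars_eq_insertionSort (m : List JVar) :
    sortVars m = m.insertionSort (fun v w : JVar => JVar.cmp w v ≠ .lt) := by
  induction m with
  | nil => rw [List.insertionSort_nil]; rfl
  | cons v m ih => rw [sortVars_cons, ih, insertVar_eq_orderedInsert, List.insertionSort_cons]

/-- `sortVars m` is a permutation of `m`. -/
theorem perm_sortVars (m : List JVar) : (sortVars m).Perm m := by
  rw [sortVars_eq_insertionSort]
  exact List.perm_insertionSort _ _

/-- `sortVars m` is `≼`-sorted. -/
theorem pairwise_sortVars (m : List JVar) : (sortVars m).Pairwise (fun v w : JVar => JVar.cmp w v ≠ .lt) := by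
  haveI : Std.Total (fun v w : JVar => JVar.cmp w v ≠ .lt) := ⟨JVar.le_total⟩
  haveI : IsTrans JVar (fun v w : JVar => JVar.cmp w v ≠ .lt) := ⟨fun _ _ _ => JVar.le_trans⟩
  rw [sortVars_eq_insertionSort]
  exact List.pairwise_insertionSort _ _

/-- A monomial is fixed by `sortVars` iff it is `≼`-sorted. -/
theorem sortVars_eq_self_iff (m : List JVar) :
    sortVars m = m ↔ m.Pairwise (fun v w : JVar => JVar.cmp w v ≠ .lt) :=
  ⟨fun h => h ▸ pairwise_sortVars m, fun h => by rw [sortVars_eq_insertionSort]; exact h.insertionSort_eq⟩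

/-- `≼`-sorted permutations of each other are equal. -/
theorem eq_of_perm_of_pairwise {l l' : List JVar} (hp : l.Perm l')
    (hl : l.Pairwise (fun v w : JVar => JVar.cmp w v ≠ .lt)) (hl' : l'.Pairwise (fun v w : JVar => JVar.cmp w v ≠ .lt)) :
    l = l' :=
  hp.eq_of_pairwise (fun _ _ _ _ h₁ h₂ => JVar.le_antisymm h₁ h₂) hl hl'

/-- `sortVars` is invariant under permutations of its input. -/
theorem sortVars_eq_of_perm {l l' : List JVar} (h : l.Perm l') : sortVars l = sortVars l' :=
  eq_of_perm_of_pairwise (((perm_sortVars l).trans h).trans (perm_sortVars l').symm) (pairwise_sortVars l)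
    (pairwise_sortVars l')

/-- `sortVars` is idempotent. -/
theorem sortVars_sortVars (m : List JVar) : sortVars (sortVars m) = sortVars m :=
  sortVars_eq_of_perm (perm_sortVars m)

/-- Lists with the same sorting are permutations of each other. -/
theorem perm_of_sortVars_eq {l l' : List JVar} (h : sortVars l = sortVars l') : l.Perm l' :=
  ((perm_sortVars l).symm.trans (h ▸ List.Perm.refl _)).trans (perm_sortVars l')

/-- `insertIdx` is `List.orderedInsert` for `≤` on `Fin 3`. -/
theorem insertIdx_eq_orderedInsert (i : Fin 3) (l : List (Fin 3)) : insertIdx i l = l.orderedInsert (· ≤ ·) i := by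
  induction l with
  | nil => rfl
  | cons j js ih =>
    simp only [insertIdx, List.orderedInsert_cons]
    by_cases h : j < i
    · simp [h, not_le.2 h, ih]
    · simp [h, not_lt.1 h]

/-- `sortIdx` is `List.insertionSort` for `≤` on `Fin 3`. -/
theorem sortIdx_eq_insertionSort (l : List (Fin 3)) : sortIdx l = l.insertionSort (· ≤ ·) := by
  induction l with
  | nil => rw [List.insertionSort_nil]; rfl
  | cons i l ih =>
    rw [List.insertionSort_cons, ← ih, ← insertIdx_eq_orderedInsert]
    rfl

/-- An index list is fixed by `sortIdx` iff it is sorted. -/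
theorem sortIdx_eq_self_iff (l : List (Fin 3)) : sortIdx l = l ↔ l.Pairwise (· ≤ ·) := by
  rw [sortIdx_eq_insertionSort]
  exact ⟨fun h => h ▸ List.pairwise_insertionSort _ _, fun h => h.insertionSort_eq⟩

/-! ### The enumerations `sortedIdxFrom`, `varsOfOrder`, `shapes` -/

/-- A `flatMap` over a duplicate-free list is duplicate-free when the pieces are duplicate-free and every element
of a piece remembers (an injective image of) the index of its piece. -/
theorem nodup_flatMap_of_key {α β γ : Type*} {l : List α} (hl : l.Nodup) {f : α → List β}
    (hf : ∀ a ∈ l, (f a).Nodup) (key : β → γ) (g : α → γ) (hg : Function.Injective g)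
    (hkey : ∀ a ∈ l, ∀ b ∈ f a, key b = g a) : (l.flatMap f).Nodup :=
  List.nodup_flatMap.2 ⟨hf, hl.pairwise_of_forall_ne fun a ha a' ha' hne b hb hb' =>
    hne (hg ((hkey a ha b hb).symm.trans (hkey a' ha' b hb')))⟩

/-- Membership in `sortedIdxFrom n i₀`: exactly the sorted index lists of length `n` with entries `≥ i₀`. -/
theorem mem_sortedIdxFrom_iff {n : ℕ} {i₀ : Fin 3} {l : List (Fin 3)} :
    l ∈ sortedIdxFrom n i₀ ↔ l.length = n ∧ l.Pairwise (· ≤ ·) ∧ ∀ x ∈ l, i₀ ≤ x := by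
  induction n generalizing i₀ l with
  | zero =>
    simp only [sortedIdxFrom, List.mem_singleton, List.length_eq_zero_iff]
    constructor
    · rintro rfl
      simp
    · rintro ⟨rfl, -, -⟩
      rfl
  | succ n ih =>
    simp only [sortedIdxFrom, List.mem_flatMap, List.mem_finRange, true_and, List.mem_ite_nil_left,
      List.mem_map, not_lt]
    constructor
    · rintro ⟨i, hi, l', hl', rfl⟩
      obtain ⟨hlen, hsort, hge⟩ := ih.1 hl'
      refine ⟨by simp [hlen], List.pairwise_cons.2 ⟨hge, hsort⟩, fun x hx => ?_⟩
      rcases List.mem_cons.1 hx with rfl | hx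
      · exact hi
      · exact le_trans hi (hge x hx)
    · rintro ⟨hlen, hsort, hge⟩
      cases l with
      | nil => simp at hlen
      | cons i l' =>
        refine ⟨i, hge i List.mem_cons_self, l', ih.2 ?_, rfl⟩
        exact ⟨by simpa using hlen, (List.pairwise_cons.1 hsort).2, (List.pairwise_cons.1 hsort).1⟩

/-- `sortedIdxFrom n i₀` is duplicate-free. -/
theorem nodup_sortedIdxFrom (n : ℕ) (i₀ : Fin 3) : (sortedIdxFrom n i₀).Nodup := by
  induction n generalizing i₀ with
  | zero => simp [sortedIdxFrom]
  | succ n ih =>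
    simp only [sortedIdxFrom]
    refine nodup_flatMap_of_key (List.nodup_finRange 3) (fun i _ => ?_) (fun l => l.headD 0) id
      Function.injective_id (fun i _ l hl => ?_)
    · split_ifs
      · exact List.nodup_nil
      · exact (ih i).map List.cons_injective
    · simp only [List.mem_ite_nil_left, List.mem_map] at hl
      obtain ⟨-, l', -, rfl⟩ := hl
      rfl

/-- Membership in `varsOfOrder n`: exactly the variables with a sorted index list of length `n`. -/
theorem mem_varsOfOrder_iff {n : ℕ} {v : JVar} : v ∈ varsOfOrder n ↔ v.2.length = n ∧ sortIdx v.2 = v.2 := by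
  obtain ⟨a, l⟩ := v
  simp only [varsOfOrder, sortedIdx, List.mem_flatMap, List.mem_finRange, true_and, List.mem_map,
    Prod.mk.injEq]
  rw [sortIdx_eq_self_iff]
  constructor
  · rintro ⟨a', l', hl', rfl, rfl⟩
    have h := mem_sortedIdxFrom_iff.1 hl'
    exact ⟨h.1, h.2.1⟩
  · rintro ⟨hlen, hsort⟩
    exact ⟨a, l, mem_sortedIdxFrom_iff.2 ⟨hlen, hsort, fun x _ => Fin.zero_le x⟩, rfl, rfl⟩

/-- The derivative order of a listed variable. -/
theorem length_of_mem_varsOfOrder {n : ℕ} {v : JVar} (h : v ∈ varsOfOrder n) : v.2.length = n :=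
  (mem_varsOfOrder_iff.1 h).1

/-- Variables of different derivative orders are different. -/
theorem ne_of_mem_varsOfOrder {n n' : ℕ} {v w : JVar} (hv : v ∈ varsOfOrder n) (hw : w ∈ varsOfOrder n')
    (h : n ≠ n') : v ≠ w :=
  fun e => h ((length_of_mem_varsOfOrder hv).symm.trans (e ▸ length_of_mem_varsOfOrder hw))

/-- `varsOfOrder n` is duplicate-free. -/
theorem nodup_varsOfOrder (n : ℕ) : (varsOfOrder n).Nodup := by
  refine nodup_flatMap_of_key (List.nodup_finRange 3) (fun a _ => ?_) Prod.fst id Function.injective_id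
    (fun a _ v hv => ?_)
  · exact (nodup_sortedIdxFrom n 0).map fun l l' h => (Prod.mk.inj h).2
  · simp only [List.mem_map] at hv
    obtain ⟨l, -, rfl⟩ := hv
    rfl

/-- Membership in `shapes k`: the sorted triples `n₁ ≤ n₂ ≤ n₃ ≤ 3` of sum `k`. -/
theorem mem_shapes_iff {k : ℕ} {sh : List ℕ} :
    sh ∈ shapes k ↔ ∃ n₁ n₂ n₃, n₁ ≤ n₂ ∧ n₂ ≤ n₃ ∧ n₃ ≤ 3 ∧ n₁ + n₂ + n₃ = k ∧ sh = [n₁, n₂, n₃] := by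
  simp only [shapes, List.mem_flatMap, List.mem_range, List.mem_ite_nil_right, List.mem_singleton]
  constructor
  · rintro ⟨n₁, -, n₂, -, n₃, h₃, ⟨hk, h₁₂, h₂₃⟩, rfl⟩
    exact ⟨n₁, n₂, n₃, h₁₂, h₂₃, by omega, hk, rfl⟩
  · rintro ⟨n₁, n₂, n₃, h₁₂, h₂₃, h₃, hk, rfl⟩
    exact ⟨n₁, by omega, n₂, by omega, n₃, by omega, ⟨hk, h₁₂, h₂₃⟩, rfl⟩

/-- `flatMap` is monotone for the sublist order in the function argument. -/
theorem flatMap_sublist_flatMap {α β : Type*} {f g : α → List β} (h : ∀ a, (f a).Sublist (g a)) :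
    ∀ l : List α, (l.flatMap f).Sublist (l.flatMap g)
  | [] => List.Sublist.slnil
  | a :: l => by
    simp only [List.flatMap_cons]
    exact (h a).append (flatMap_sublist_flatMap h l)

/-- `shapes k` is duplicate-free (a sublist of the duplicate-free list of all triples below `4`). -/
theorem nodup_shapes (k : ℕ) : (shapes k).Nodup := by
  have hsub : (shapes k).Sublist ((List.range 4).flatMap fun n₁ => (List.range 4).flatMap fun n₂ =>
      (List.range 4).flatMap fun n₃ => [[n₁, n₂, n₃]]) := by
    unfold shapes
    refine flatMap_sublist_flatMap (fun n₁ => flatMap_sublist_flatMap (fun n₂ =>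
      flatMap_sublist_flatMap (fun n₃ => ?_) _) _) _
    split <;> simp
  exact hsub.nodup (by decide)

end Summit.NavierStokesRegularity.NavierStokesRegularity.Theorems.OddMorawetz

end
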